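import Summits.ResolutionOfSingularities.ResolutionOfSingularities.Theorems.EquisingularLiftEquisingularLiftCurveCase
import Literature.AlgebraicGeometry.Resolution.BertiniAffine
import HarnessLib

/-!
# Line `Sketch` (= `strata-split` composition v6) — proof skeleton for the crux `EquisingularLift`
# (stmt-ResolutionOfSingularities-15660)

Line lead `prover-line-stmt-ResolutionOfSingularities-15660-a1-0` (gen 1, lead a1, 2026-08-17).

The payload line `Sketch` is the planners' first-lemma sketch of the five crux idea cards
(`Cruxes/EquisingularLift/Ideas/*.md`); it has no composition, so the composition used here is the crux's
registered one (`Lines/strata_split.lean` v5: `equisingularLift_of_ge_three`, with EL for `n ≤ 2` a THEOREM,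
`equisingularLift_of_le_two`, p171618), RESHAPED (v6): the two v5 open stubs (`stub_liftableIsolation_infinite`,
`stub_resolveOnePoint_higher`, open problems as typed) are replaced by

* six MOVE-SET stubs — the local algebra that every idea card needs before its global step (all theorem-sized):
  - `stub_linkedNode_regular` (`linked-ci-centres`, lemma 2): the `O`-total space of a linked complete-intersection
    centre `V(f, xy + ϖu)` is regular at a node and `ϖ` does not vanish on it;
  - `stub_exists_arc_transversal` (`free-arcs-jet-surgery`, lemma 1, WITHOUT completeness/Cohen hypotheses): through
    every point of a regular local `O`-germ, good or bad, there is a regular horizontal arc `V(𝔮)` (`R/𝔮` a DVR,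
    `ϖ ∉ 𝔮`) transversal to any ideal `I ⊄ 𝔪²` (`𝔮 + I = 𝔪`);
  - `stub_goodGenerators_of_hypersurfaceLike` (`toric-stars` LHR alphabet / `free-arcs` lemma 2, special-fibre half):
    a complete-intersection ideal of the right dimension whose quotient is hypersurface-like (`edim ≤ dim + 1`) has a
    generating set all but the last of which is part of a regular system of parameters;
  - `stub_regularLift_of_not_dvd` (`free-arcs` lemma 2, lifting half, one equation): `g ↦ g + ϖh` makes `R/(g + ϖh)`
    regular with `ϖ` non-zero on it;
  - `stub_trace_hypersurfaceLike` (converse of the trace dictionary): the special fibre `R/(𝔮 + ϖ)` of a regular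
    horizontal subgerm `R/𝔮` is hypersurface-like of dimension one less;
  - `stub_bertiniWithBaseCurve` (`linked-ci-centres`, lemma 1): Bertini for a linear system with a base CURVE, on the
    tree's `BertiniAffine`;
* ONE residual stub `stub_equisingularLift_ge_three_of_moves`: EL for `n ≥ 3` GIVEN the six move-set statements — the
  honest remainder (K-game solvability at isolated points + link-damage table + configuration lifting of the cards;
  `n ≥ 5` is at least the summit over `k̄`, `Theorems.EquisingularLift.resolutionOverAlgClosed_of_equisingularLift`,
  p165577).

Composition: `EquisingularLift_of := equisingularLift_of_ge_three (stub_equisingularLift_ge_three_of_moves stub₁ … stub₆)`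
— concludes the crux BY NAME; `sorry` only inside the seven `stub_*`.
-/

set_option linter.dupNamespace false -- mandated namespace `Summit.<Summit>.<Problem>` of this single-conjunct summit
set_option linter.overlappingInstances false -- registered signatures carry `[IsDomain O] [IsDiscreteValuationRing O]`

noncomputable section

namespace Summit.ResolutionOfSingularities.ResolutionOfSingularities.Cruxes.EquisingularLift.StrataSplit

/-! ## Move-set stubs (local algebra of regular local rings over a DVR; `ϖ` = the uniformizer) -/

/-- **STUB `stub_linkedNode_regular`** (linked-CI node). In a regular local ring `R` let `f ∈ 𝔪 ∖ 𝔪²`,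
`ϖ ∈ 𝔪` with `ϖ ∉ 𝔪² + (f)`, `x, y ∈ 𝔪` both outside `(f, ϖ)`, and `u` a unit. Then `R/(f, xy + ϖu)` is a regular
local ring of dimension `dim R - 2` on which `ϖ` is non-zero (the total space `{xy = ϖ}`-type node of a linked centre
is regular and `O`-flat). -/
theorem stub_linkedNode_regular : ∀ (R : Type) [CommRing R] [IsRegularLocalRing R] (ϖ f x y u : R), IsUnit u → ϖ ∈ IsLocalRing.maximalIdeal R → f ∈ IsLocalRing.maximalIdeal R → f ∉ IsLocalRing.maximalIdeal R ^ 2 → x ∈ IsLocalRing.maximalIdeal R → y ∈ IsLocalRing.maximalIdeal R → ϖ ∉ IsLocalRing.maximalIdeal R ^ 2 ⊔ Ideal.span {f} → x ∉ Ideal.span {f, ϖ} → y ∉ Ideal.span {f, ϖ} → IsRegularLocalRing (R ⧸ Ideal.span {f, x * y + ϖ * u}) ∧ ringKrullDim (R ⧸ Ideal.span {f, x * y + ϖ * u}) + 2 = ringKrullDim R ∧ ϖ ∉ Ideal.span {f, x * y + ϖ * u} := by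
  sorry

/-- **STUB `stub_exists_arc_transversal`** (free arcs through any point). In a regular local ring `R` with infinite
residue field, for every non-zero `ϖ` and every ideal `I ⊆ 𝔪` not contained in `𝔪²` there is an ideal `𝔮` with `R/𝔮`
regular local of dimension `1` (a DVR: the arc), `ϖ ∉ 𝔮` (horizontal) and `𝔮 + I = 𝔪` (the arc's trace generates the
maximal ideal of `R/I`). Proof idea: induction on `dim R`, cutting by `w + c·g` (`g ∈ I ∖ 𝔪²`) for one of infinitely
many residue classes `c`, only finitely many of which divide `ϖ` (Krull intersection). -/
theorem stub_exists_arc_transversal : ∀ (R : Type) [CommRing R] [IsRegularLocalRing R], Infinite (IsLocalRing.ResidueField R) → ∀ (ϖ : R) (I : Ideal R), ϖ ≠ 0 → I ≤ IsLocalRing.maximalIdeal R → ¬ I ≤ IsLocalRing.maximalIdeal R ^ 2 → ∃ 𝔮 : Ideal R, IsRegularLocalRing (R ⧸ 𝔮) ∧ ringKrullDim (R ⧸ 𝔮) = 1 ∧ ϖ ∉ 𝔮 ∧ 𝔮 ⊔ I = IsLocalRing.maximalIdeal R := by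
  sorry

/-- **STUB `stub_goodGenerators_of_hypersurfaceLike`** (LHR alphabet, special-fibre half). In a regular local ring `R`,
an ideal `J ⊆ 𝔪` generated by at most `c + 1` elements with `dim R/J + (c + 1) = dim R` (complete intersection of the
right dimension) and `edim R/J ≤ dim R/J + 1` (hypersurface-like) is generated by `c + 1` elements the first `c` of
which are part of a regular system of parameters (`R/(g₀, …, g_{c-1})` regular of dimension `dim R - c`). -/
theorem stub_goodGenerators_of_hypersurfaceLike : ∀ (R : Type) [CommRing R] [IsRegularLocalRing R] (J : Ideal R) (c : ℕ), J ≤ IsLocalRing.maximalIdeal R → J.spanFinrank ≤ c + 1 → ringKrullDim (R ⧸ J) + (c + 1) = ringKrullDim R → ((Ideal.map (Ideal.Quotient.mk J) (IsLocalRing.maximalIdeal R)).spanFinrank : WithBot ℕ∞) ≤ ringKrullDim (R ⧸ J) + 1 → ∃ g : Fin (c + 1) → R, J = Ideal.span (Set.range g) ∧ IsRegularLocalRing (R ⧸ Ideal.span (Set.range (fun i : Fin c => g i.castSucc))) ∧ ringKrullDim (R ⧸ Ideal.span (Set.range (fun i : Fin c => g i.castSucc))) + c = ringKrullDim R := by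
  sorry

/-- **STUB `stub_regularLift_of_not_dvd`** (lifting half, one equation). In a regular local ring `R` with
`ϖ ∈ 𝔪 ∖ 𝔪²` and `g ∈ 𝔪` not divisible by `ϖ`, some re-lift `g + ϖh` of `g mod ϖ` cuts out a regular hypersurface
`R/(g + ϖh)` of dimension `dim R - 1` on which `ϖ` is non-zero (take `h = 0` if `g ∉ 𝔪²`, else `h = 1`). -/
theorem stub_regularLift_of_not_dvd : ∀ (R : Type) [CommRing R] [IsRegularLocalRing R] (ϖ g : R), ϖ ∈ IsLocalRing.maximalIdeal R → ϖ ∉ IsLocalRing.maximalIdeal R ^ 2 → g ∈ IsLocalRing.maximalIdeal R → ¬ (ϖ ∣ g) → ∃ h : R, IsRegularLocalRing (R ⧸ Ideal.span {g + ϖ * h}) ∧ ringKrullDim (R ⧸ Ideal.span {g + ϖ * h}) + 1 = ringKrullDim R ∧ ϖ ∉ Ideal.span {g + ϖ * h} := by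
  sorry

/-- **STUB `stub_trace_hypersurfaceLike`** (trace dictionary, converse). If `R/𝔮` is regular local and `ϖ ∈ 𝔪 ∖ 𝔮`,
then the trace `R/(𝔮 + ϖ)` has dimension `dim R/𝔮 - 1` and embedding dimension `≤ dim + 1`. -/
theorem stub_trace_hypersurfaceLike : ∀ (R : Type) [CommRing R] [IsRegularLocalRing R] (𝔮 : Ideal R) (ϖ : R), IsRegularLocalRing (R ⧸ 𝔮) → ϖ ∈ IsLocalRing.maximalIdeal R → ϖ ∉ 𝔮 → ringKrullDim (R ⧸ (𝔮 ⊔ Ideal.span {ϖ})) + 1 = ringKrullDim (R ⧸ 𝔮) ∧ ((Ideal.map (Ideal.Quotient.mk (𝔮 ⊔ Ideal.span {ϖ})) (IsLocalRing.maximalIdeal R)).spanFinrank : WithBot ℕ∞) ≤ ringKrullDim (R ⧸ (𝔮 ⊔ Ideal.span {ϖ})) + 1 := by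
  sorry

/-- **STUB `stub_bertiniWithBaseCurve`** (Bertini with a base curve, affine local-algebra form). `A` a regular algebra
of finite type over an algebraically closed field `k`, `𝔭` a prime with `dim A/𝔭 ≤ 1` (the base curve `Σ`),
`u : ι → A` sections vanishing on `Σ`; off `Σ` they fill `A/𝔪²`, on `Σ` they give `≥ 2` independent directions in
`𝔪/𝔪²`. Then for generic `t` the member `V(Σ tⱼ uⱼ)` is regular at every closed point it passes through. -/
theorem stub_bertiniWithBaseCurve : ∀ (k : Type) [Field k] [IsAlgClosed k] (A : Type) [CommRing A] [Algebra k A] [IsRegularRing A] [Algebra.FiniteType k A] (ι : Type) [Fintype ι] (u : ι → A) (𝔭 : Ideal A) [𝔭.IsPrime], (∀ j, u j ∈ 𝔭) → ringKrullDim (A ⧸ 𝔭) ≤ 1 → (∀ 𝔪 : Ideal A, 𝔪.IsMaximal → ¬ 𝔭 ≤ 𝔪 → Function.Surjective (Literature.AlgebraicGeometry.Resolution.BertiniAffine.linCombQuotSq (k := k) u 𝔪)) → (∀ 𝔪 : Ideal A, 𝔪.IsMaximal → 𝔭 ≤ 𝔪 → 2 ≤ Module.finrank k (LinearMap.range (Literature.AlgebraicGeometry.Resolution.BertiniAffine.linCombQuotSq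 (k := k) u 𝔪))) → Literature.AlgebraicGeometry.Resolution.IsGeneric fun t : ι → k => ∀ (𝔪 : Ideal A) [𝔪.IsMaximal], Literature.AlgebraicGeometry.Resolution.BertiniAffine.linComb u t ∈ 𝔪 → IsRegularLocalRing (Localization.AtPrime 𝔪 ⧸ Ideal.span {algebraMap A (Localization.AtPrime 𝔪) (Literature.AlgebraicGeometry.Resolution.BertiniAffine.linComb u t)}) := by
  sorry

/-! ## The residual stub -/

/-- **STUB `stub_equisingularLift_ge_three_of_moves`** (OPEN — the residual of the crux). EL for `n ≥ 3`, GIVEN the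
six move-set statements above (in order: linked node, transversal arcs, good generators, regular lift, trace,
based Bertini). What remains is the cards' programme proper: for `n = 3`, Cossart–Jannsen–Saito centres replaced by
liftable links/arcs plus the damage/repair table at link vertices and the K-game at isolated (bad) points; for
`n ≥ 5` at least resolution in characteristic `p` (p165577). -/
theorem stub_equisingularLift_ge_three_of_moves : (∀ (R : Type) [CommRing R] [IsRegularLocalRing R] (ϖ f x y u : R), IsUnit u → ϖ ∈ IsLocalRing.maximalIdeal R → f ∈ IsLocalRing.maximalIdeal R → f ∉ IsLocalRing.maximalIdeal R ^ 2 → x ∈ IsLocalRing.maximalIdeal R → y ∈ IsLocalRing.maximalIdeal R → ϖ ∉ IsLocalRing.maximalIdeal R ^ 2 ⊔ Ideal.span {f} → x ∉ Ideal.span {f, ϖ} → y ∉ Ideal.span {f, ϖ} → IsRegularLocalRing (R ⧸ Ideal.span {f, x * y + ϖ * u}) ∧ ringKrullDim (R ⧸ Ideal.span {f, x * y + ϖ * u}) + 2 = ringKrullDim R ∧ ϖ ∉ Ideal.span {f, x * y + ϖ * u}) → (∀ (R : Type) [CommRing R] [IsRegularLocalRing R], Infinite (IsLocalRing.ResidueField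 R) → ∀ (ϖ : R) (I : Ideal R), ϖ ≠ 0 → I ≤ IsLocalRing.maximalIdeal R → ¬ I ≤ IsLocalRing.maximalIdeal R ^ 2 → ∃ 𝔮 : Ideal R, IsRegularLocalRing (R ⧸ 𝔮) ∧ ringKrullDim (R ⧸ 𝔮) = 1 ∧ ϖ ∉ 𝔮 ∧ 𝔮 ⊔ I = IsLocalRing.maximalIdeal R) → (∀ (R : Type) [CommRing R] [IsRegularLocalRing R] (J : Ideal R) (c : ℕ), J ≤ IsLocalRing.maximalIdeal R → J.spanFinrank ≤ c + 1 → ringKrullDim (R ⧸ J) + (c + 1) = ringKrullDim R → ((Ideal.map (Ideal.Quotient.mk J) (IsLocalRing.maximalIdeal R)).spanFinrank : WithBot ℕ∞) ≤ ringKrullDim (R ⧸ J) + 1 → ∃ g : Fin (c + 1) → R, J = Ideal.span (Set.range g) ∧ IsRegularLocalRing (R ⧸ Ideal.span (Set.range (fun i : Fin c => g i.castSucc))) ∧ ringKrullDim (R ⧸ Ideal.span (Set.range (fun i : Fin c => g i.castSucc))) + c = ringKrullDim R) → (∀ (R : Type) [CommRing R] [IsRegularLocalRing R] (ϖ g : R),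 ϖ ∈ IsLocalRing.maximalIdeal R → ϖ ∉ IsLocalRing.maximalIdeal R ^ 2 → g ∈ IsLocalRing.maximalIdeal R → ¬ (ϖ ∣ g) → ∃ h : R, IsRegularLocalRing (R ⧸ Ideal.span {g + ϖ * h}) ∧ ringKrullDim (R ⧸ Ideal.span {g + ϖ * h}) + 1 = ringKrullDim R ∧ ϖ ∉ Ideal.span {g + ϖ * h}) → (∀ (R : Type) [CommRing R] [IsRegularLocalRing R] (𝔮 : Ideal R) (ϖ : R), IsRegularLocalRing (R ⧸ 𝔮) → ϖ ∈ IsLocalRing.maximalIdeal R → ϖ ∉ 𝔮 → ringKrullDim (R ⧸ (𝔮 ⊔ Ideal.span {ϖ})) + 1 = ringKrullDim (R ⧸ 𝔮) ∧ ((Ideal.map (Ideal.Quotient.mk (𝔮 ⊔ Ideal.span {ϖ})) (IsLocalRing.maximalIdeal R)).spanFinrank : WithBot ℕ∞) ≤ ringKrullDim (R ⧸ (𝔮 ⊔ Ideal.span {ϖ})) + 1) → (∀ (k : Type) [Field k] [IsAlgClosed k] (A : Type) [CommRing A] [Algebra k A] [IsRegularRing A] [Algebra.FiniteType k A] (ι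 : Type) [Fintype ι] (u : ι → A) (𝔭 : Ideal A) [𝔭.IsPrime], (∀ j, u j ∈ 𝔭) → ringKrullDim (A ⧸ 𝔭) ≤ 1 → (∀ 𝔪 : Ideal A, 𝔪.IsMaximal → ¬ 𝔭 ≤ 𝔪 → Function.Surjective (Literature.AlgebraicGeometry.Resolution.BertiniAffine.linCombQuotSq (k := k) u 𝔪)) → (∀ 𝔪 : Ideal A, 𝔪.IsMaximal → 𝔭 ≤ 𝔪 → 2 ≤ Module.finrank k (LinearMap.range (Literature.AlgebraicGeometry.Resolution.BertiniAffine.linCombQuotSq (k := k) u 𝔪))) → Literature.AlgebraicGeometry.Resolution.IsGeneric fun t : ι → k => ∀ (𝔪 : Ideal A) [𝔪.IsMaximal], Literature.AlgebraicGeometry.Resolution.BertiniAffine.linComb u t ∈ 𝔪 → IsRegularLocalRing (Localization.AtPrime 𝔪 ⧸ Ideal.span {algebraMap A (Localization.AtPrime 𝔪) (Literature.AlgebraicGeometry.Resolution.BertiniAffine.linComb u t)})) → ∀ p : ℕ, p.Prime → ∀ (k : Type) [Field k] [CharP k p] [IsAlgClosed k] (n : ℕ) (H : AlgebraicGeometry.Scheme.{0})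 (ι : H ⟶ (Literature.AlgebraicGeometry.Motives.projectiveSpace n k).left), AlgebraicGeometry.IsClosedImmersion ι → AlgebraicGeometry.IsIntegral H → (∀ y : (Literature.AlgebraicGeometry.Motives.projectiveSpace n k).left, ∃ U : (Literature.AlgebraicGeometry.Motives.projectiveSpace n k).left.affineOpens, y ∈ (U : (Literature.AlgebraicGeometry.Motives.projectiveSpace n k).left.Opens) ∧ (ι.ker.ideal U).IsPrincipal) → 3 ≤ n → ∃ (O : Type) (_ : CommRing O) (_ : IsDomain O) (_ : IsDiscreteValuationRing O) (_ : CharZero O) (P P' : AlgebraicGeometry.Scheme.{0}) (q : P ⟶ AlgebraicGeometry.Spec (.of O)) (Y : TopologicalSpace.Closeds P) (σ : P' ⟶ P) (S' : Set P'), AlgebraicGeometry.Smooth q ∧ AlgebraicGeometry.IsProper q ∧ (Y : Set P) ⊆ q ⁻¹' {IsLocalRing.closedPoint O} ∧ Nonempty ((AlgebraicGeometry.Scheme.IdealSheafData.vanishingIdeal Y).subscheme ≅ H) ∧ (∀ Q : (∀ X' : AlgebraicGeometry.Scheme.{0}, (X' ⟶ P) → Set X' → Prop), Q P (CategoryTheory.CategoryStruct.id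 P) (Y : Set P) → (∀ (X' X'' : AlgebraicGeometry.Scheme.{0}) (σ' : X' ⟶ P) (Y' : Set X') (C : X'.IdealSheafData) (τ : X'' ⟶ X'), Q X' σ' Y' → Literature.AlgebraicGeometry.Resolution.IsBlowup τ C → Literature.AlgebraicGeometry.Resolution.Scheme.IsRegular C.subscheme → σ' '' (C.support : Set X') ⊆ {x : P | ¬ IsGenericPoint x (Y : Set P)} → Q X'' (CategoryTheory.CategoryStruct.comp τ σ') (closure (τ ⁻¹' (Y' \ (C.support : Set X'))))) → Q P' σ S') ∧ IsIrreducible ((CategoryTheory.CategoryStruct.comp σ q) ⁻¹' {IsLocalRing.closedPoint O}) ∧ Literature.AlgebraicGeometry.Resolution.Scheme.IsRegular (AlgebraicGeometry.Scheme.IdealSheafData.vanishingIdeal (⟨closure S', isClosed_closure⟩ : TopologicalSpace.Closeds P')).subscheme := by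
  sorry

/-! ## The crux -/

/-- **`EquisingularLift` from the seven stub statements** (conclusion = the route decl, by name): the `n ≤ 2` half is
the theorem `equisingularLift_of_le_two` inside `equisingularLift_of_ge_three`; the `n ≥ 3` half is the residual stub
fed by the six move-set stubs. -/
theorem EquisingularLift_of :
    Summit.ResolutionOfSingularities.ResolutionOfSingularities.Theses.EquisingularLift.EquisingularLift :=
  equisingularLift_of_ge_three (stub_equisingularLift_ge_three_of_moves stub_linkedNode_regular
    stub_exists_arc_transversal stub_goodGenerators_of_hypersurfaceLike stub_regularLift_of_not_dvd
    stub_trace_hypersurfaceLike stub_bertiniWithBaseCurve)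

/-- The crux, assembled (only `sorry`s in its closure: the registered stubs). -/
theorem EquisingularLift_proof :
    Summit.ResolutionOfSingularities.ResolutionOfSingularities.Theses.EquisingularLift.EquisingularLift :=
  EquisingularLift_of

end Summit.ResolutionOfSingularities.ResolutionOfSingularities.Cruxes.EquisingularLift.StrataSplit

end
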